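import Summits.KontsevichZagierPeriods.KontsevichZagierPeriods.Theses.SymplecticScissors
import Summits.KontsevichZagierPeriods.KontsevichZagierPeriods.Theorems.SymplecticScissorsTypeAGenerationRoomNormalisation
import Summits.KontsevichZagierPeriods.KontsevichZagierPeriods.Theorems.SymplecticScissorsTypeAGenerationStubDlogOfSmallDeviation
import Literature.NumberTheory.Transcendental.AyoubPeriodSeriesLocalizing
import Literature.NumberTheory.Transcendental.AyoubPeriodSeriesDescent
import Literature.NumberTheory.Transcendental.BakerCoefficientForm
import Summits.KontsevichZagierPeriods.KontsevichZagierPeriods.Theorems.SymplecticScissorsTypeAGenerationStubBinGermMemOan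
import Summits.KontsevichZagierPeriods.KontsevichZagierPeriods.Theorems.SymplecticScissorsTypeAGenerationStubBinGermCalculus
import Summits.KontsevichZagierPeriods.KontsevichZagierPeriods.Theorems.SymplecticScissorsTypeAGenerationStubBinGermValues
import Summits.KontsevichZagierPeriods.KontsevichZagierPeriods.Theorems.SymplecticScissorsTypeAGenerationStubBakerSplit
import Summits.KontsevichZagierPeriods.KontsevichZagierPeriods.Theorems.SymplecticScissorsTypeAGenerationStubNormalForms
import Summits.KontsevichZagierPeriods.KontsevichZagierPeriods.Theorems.SymplecticScissorsTypeAGenerationStubExactDlog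
import Summits.KontsevichZagierPeriods.KontsevichZagierPeriods.Theorems.TypeAGeneration.Negative.HypothesesAudit
import Summits.KontsevichZagierPeriods.KontsevichZagierPeriods.Theorems.SymplecticScissorsTypeAGenerationStubRootElimination
import Summits.KontsevichZagierPeriods.KontsevichZagierPeriods.Theorems.SymplecticScissorsTypeAGenerationStubPartialFractions
import Summits.KontsevichZagierPeriods.KontsevichZagierPeriods.Theorems.SymplecticScissorsTypeAGenerationRatOneVarLayer
import Summits.KontsevichZagierPeriods.KontsevichZagierPeriods.Theorems.SymplecticScissorsTypeAGenerationStubCovPolyAux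
import Summits.KontsevichZagierPeriods.KontsevichZagierPeriods.Theorems.SymplecticScissorsTypeAGenerationStubCovSubstAnalytic
import Summits.KontsevichZagierPeriods.KontsevichZagierPeriods.Theorems.SymplecticScissorsTypeAGenerationStubCovSubstMemOan
import Summits.KontsevichZagierPeriods.KontsevichZagierPeriods.Theorems.SymplecticScissorsTypeAGenerationStubCovChainRule
import Summits.KontsevichZagierPeriods.KontsevichZagierPeriods.Theorems.SymplecticScissorsTypeAGenerationStubCovFaces
import Summits.KontsevichZagierPeriods.KontsevichZagierPeriods.Theorems.SymplecticScissorsTypeAGenerationStubMultiPieceRatLayer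
import Summits.KontsevichZagierPeriods.KontsevichZagierPeriods.Theorems.SymplecticScissorsTypeAGenerationStubRenameSpan
import Summits.KontsevichZagierPeriods.KontsevichZagierPeriods.Theorems.SymplecticScissorsTypeAGenerationStubModuleDisjoint
import Summits.KontsevichZagierPeriods.KontsevichZagierPeriods.Theorems.SymplecticScissorsTypeAGenerationChangeOfVariablesDimOne
import Summits.KontsevichZagierPeriods.KontsevichZagierPeriods.Theorems.SymplecticScissorsTypeAGenerationStubSqrtInstance
import Summits.KontsevichZagierPeriods.KontsevichZagierPeriods.Theorems.SymplecticScissorsTypeAGenerationStubBarrierElement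

/-!
# `TypeAGeneration` (stmt-KontsevichZagierPeriods-18392) — line `Sketch` (card `stokes-compiler`)

Crux proof SKELETON of the line lead (continuation c1), state at the END of cycle 2. The crux
is Ayoub's Conjecture 1.1 (Ann. of Math. 181 (2015)) = Fresán's Conjecture 3.5 (X-UPS 2024),
verbatim the tree's conjecture leaf `TypeAGenerationConjecture`: for `σ : k →+* ℂ` with algebraic
image, every `F ∈ 𝒪_{k-alg}(𝔻̄^∞)` (`AyoubRel.Oan σ`) with `∫_{[0,1]^∞} F = 0` (`AyoubRel.intC`)
lies in the `k`-span of the type-(a) elements `∂G/∂zᵢ − G|_{zᵢ=1} + G|_{zᵢ=0}` (`AyoubRel.relAC i G`).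

Cycle 1 (lead a0) LANDED engine (C1) RADIUS AMPLIFICATION (S1–S6, room lemma, ROOM NORMALISATION
`typeAGeneration_iff_residual_forall`, p146076: crux ⇔ crux for elements of arbitrarily large
polyradius) and engine (C2) INTERPOLATION CERTIFICATE with algebraic admissibility (W1–W4, A2, U0,
U1a, U1b, A3 `stub_dlogOfSmallDeviation`, p151545: dlog of every small-deviation loop is type (a)).

Cycle 2 (lead c1) LANDED, all `--supports` this crux (22 files, 16/16 workers + 5 lead assemblies;
0 stubs refuted):
* **LAYER 1** `stub_ratOneVarLayer` (p165077): Conj. 1.1 for ONE-VARIABLE RATIONAL integrands over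
  every `(k, σ)` with algebraic image, unconditional (Baker sorry-free in the tree) — rungs G1
  `stub_binGermMemOan`, G2 `stub_binGermCalculus`, G3 `stub_binGermValues`, B1 `stub_bakerSplit`,
  N1 `stub_normalForms_of`, D1 `stub_exactDlog_of` (exact integer dlog relations are type (a): the
  `N`-th-root contraction fed to A3), PF-a `stub_rootElimination`, PF-b `stub_partialFractions_of`;
* **ENGINE (C3, n = 1)** `stub_changeOfVariablesDimOne` (p168311): CHANGE OF VARIABLES IN DIMENSION
  ONE inside type (a) (Ayoub Rem. 1.5) — V0 `stub_covSubstAnalytic`, V1 `stub_covSubstMemOan_of`,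
  V2 `stub_covChainRule`, V3 `stub_covFaces_of`, `stub_covPolyAux`; **LAYER 1.5**
  `stub_genusZeroWithRoomLayer` (genus-0 one-variable integrands with room and a polynomial
  parametrisation);
* **STRUCTURE**: F2 `stub_multiPieceRatLayer` (sums of one-variable rational pieces in different
  variables, total `∫ = 0`), R `stub_renameSpan` (renaming invariance), M1 `stub_moduleDisjoint_of`
  (module structure under disjoint products: type (b) reduces to type (a));
* **INSTANCES**: F6 `stub_sqrtInstance_of` (the first irrational algebraic instance
  `√(4 − z₀) − (2/3)(8 − 3√3)`), F7 `stub_barrierElementTypeA` (the barrier catalogue's element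
  `2z₀/(2 − z₀²) − 1/(2 − z₀)` IS type (a), with auxiliary variables).

The composition below is one line and the ONLY open stub is the HONEST RESIDUAL `stub_residual`
(the crux with room; crux strength). The sector theorems are re-exported for the record.

All rungs are stated over `k = ℚ` (`algebraMap ℚ ℂ`): every instance of the crux is that instance
(`AyoubRel.typeAGeneration_forall_iff_rat`, `Oan_eq_Oan_rat_of_isAlgebraic`, `kSpan_rat_subset`).

References: Ayoub 2015 Conj. 1.1, Rem. 1.2, Rem. 1.5; Fresán 2024 Conj. 3.5, Rem. 3.6–3.7;
Baker 1975 Thm. 2.1; Ayoub, *La version relative … revisitée* §1.1 (the objects).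
-/

noncomputable section

-- `Summit.KontsevichZagierPeriods.KontsevichZagierPeriods.…` is the tree's mandated layout (single-conjunct summit).
set_option linter.dupNamespace false

namespace Summit.KontsevichZagierPeriods.KontsevichZagierPeriods.TypeAGenerationLine

open Finsupp MvPowerSeries
open Literature.NumberTheory.Transcendental
open Literature.NumberTheory.Transcendental.AyoubRel
open Summit.KontsevichZagierPeriods.KontsevichZagierPeriods.Theses.SymplecticScissors (TypeAGeneration)
open Summit.KontsevichZagierPeriods.SymplecticScissors.TypeAGenerationNegative
  (intC_eq_zero_of_mem_kSpan_relAC)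

/-- The binomial germ `(1 − zᵢ/α)^a ∈ ℂ[[z]]`: Mathlib's `(1 + X)^a` (`PowerSeries.binomialSeries`)
rescaled by `X ↦ −α⁻¹ X` and renamed into the variable `zᵢ` (as `AyoubRel.perGerm`). -/
local notation3 "binGerm[" i ", " α ", " a "]" =>
  (MvPowerSeries.rename (⇑(axisEmb i))
    (PowerSeries.rescale (-(α : ℂ)⁻¹) (PowerSeries.binomialSeries ℂ (a : ℂ)) : MvPowerSeries Unit ℂ) :
    CSeries)

set_option quotPrecheck false in
/-- The `ℚ`-span of the type-(a) elements of `𝒪_{ℚ-alg}(𝔻̄^∞)`. -/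
local notation "𝕊" =>
  kSpan (algebraMap ℚ ℂ) {x : CSeries | ∃ G ∈ Oan (algebraMap ℚ ℂ), ∃ n : ℕ, x = relAC n G}

/-- The straight-line homotopy `H = zᵢ(1 − z_j) + u(zᵢ) z_j` between `zᵢ` (`z_j = 0`) and `u(zᵢ)`
(`z_j = 1`) of Ayoub 2015 Rem. 1.5. -/
local notation3 "covH[" i ", " j ", " u "]" =>
  ((X i : CSeries) * (1 - X j) + Polynomial.aeval (X i : CSeries) u * X j)

/-- The substitution family `zᵢ ↦ H`, `z_l ↦ z_l` (`l ≠ i`). -/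
local notation3 "covFam[" i ", " j ", " u "]" =>
  (fun l : ℕ => if l = i then covH[i, j, u] else (X l : CSeries))

/-- The substitution family `zᵢ ↦ u(zᵢ)`, `z_l ↦ z_l` (`l ≠ i`). -/
local notation3 "uFam[" i ", " u "]" =>
  (fun l : ℕ => if l = i then Polynomial.aeval (X i : CSeries) u else (X l : CSeries))

/-! ## Layer 1 rungs (inside the residual)

Wave 1 LANDED (cycle 2): G1 `stub_binGermMemOan` (p163908), G2 `stub_binGermCalculus` (p163533),
G3 `stub_binGermValues` (p163741), B1 `stub_bakerSplit` (p163512), N1 `stub_normalForms_of`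
(p163795), helper `stub_exactDlogAux` (p163589), D1 `stub_exactDlog_of` (p164051, lead) —
imported above; wave 2 LANDED: PF-a `stub_rootElimination` (p164825), PF-b `stub_partialFractions_of`
(p164811); L1 `stub_ratOneVarLayer` (p165077, lead assembly) — LAYER 1 IS LANDED. -/

/-! ## Layer 1 — LANDED

`stub_ratOneVarLayer` (p165077, `…TypeAGenerationRatOneVarLayer.lean`, lead assembly of PF-a, PF-b,
N1, G3, B1, D1): **Ayoub's Conj. 1.1 holds for one-variable RATIONAL integrands** over every
`(k, σ)` with algebraic image, unconditionally. Re-exported for the record: -/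

/-- LAYER 1 (landed `stub_ratOneVarLayer`): one-variable rational `F ∈ 𝒪_{k-alg}(𝔻̄^∞)` with
algebraic coefficients and `∫ F = 0` is type (a). [cite: Ayoub2015, Conj. 1.1] -/
theorem ratOneVarLayer :
    ∀ (k : Type) [Field k] [CharZero k] (σ : k →+* ℂ), (∀ c : k, IsAlgebraic ℚ (σ c)) →
      ∀ (i : ℕ) (F : CSeries), F ∈ Oan σ → (∀ l : ℕ, UsesVar F l → l = i) →
        (∃ A B : Polynomial ℂ, B ≠ 0 ∧ (∀ n, IsAlgebraic ℚ (A.coeff n)) ∧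
          (∀ n, IsAlgebraic ℚ (B.coeff n)) ∧
          Polynomial.aeval (X i : CSeries) B * F = Polynomial.aeval (X i : CSeries) A) →
        intC F = 0 → F ∈ kSpan σ {x : CSeries | ∃ G ∈ Oan σ, ∃ n : ℕ, x = relAC n G} :=
  stub_ratOneVarLayer

/-! ## Engine (C3, n = 1): CHANGE OF VARIABLES IN DIMENSION ONE inside type (a) — wave 3

Ayoub 2015 Rem. 1.5: for a polynomial `u ∈ ℚ̄[t]` with `u(0) = 0`, `u(1) = 1` and a one-variable
`f ∈ 𝒪_{ℚ-alg}(𝔻̄^∞)` with enough ROOM (polyradius `> 2 + Σ|u_k|`; free at the crux level by the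
room normalisation), `f(zᵢ) − f(u(zᵢ)) u′(zᵢ) ∈ ⟨a⟩_ℚ`: the closed 1-form `f(H) dH` along the
straight-line homotopy `H = zᵢ(1 − z_j) + u(zᵢ) z_j` gives `A = f(H) ∂ᵢH`, `B = f(H) ∂_jH` with
`relAC j A − relAC i B = f − (f∘u) u′`. Stubs: V0 analytic substitution (`stub_covSubstAnalytic`, p167401 + aux p165907), V1 membership
(`stub_covSubstMemOan_of`, p165581), V2 chain rule (`stub_covChainRule`, p165533), V3 faces
(`stub_covFaces_of`, p166087), polynomial package `stub_covPolyAux` (p165557, lead); assembly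
`stub_changeOfVariablesDimOne` + Layer 1.5 `stub_genusZeroWithRoomLayer` (p168311, lead) — ALL LANDED. -/

/-- **COV1 — LANDED** (`stub_changeOfVariablesDimOne`, p168311, `…TypeAGenerationChangeOfVariablesDimOne.lean`,
lead assembly of V0–V3 + `stub_covPolyAux`): Ayoub's Rem. 1.5 inside type (a) —
`f − f(u(zᵢ))·u′(zᵢ) ∈ ⟨a⟩_ℚ` for one-variable `f` with room `> 2 + Σ|u_k|`, `u ∈ ℚ̄[t]`, `u(0)=0`,
`u(1)=1`. [cite: Ayoub2015, Rem. 1.5] -/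
theorem changeOfVariablesDimOne :
    ∀ (i j : ℕ), i ≠ j → ∀ (u : Polynomial ℂ), (∀ n, IsAlgebraic ℚ (u.coeff n)) →
      u.eval 0 = 0 → u.eval 1 = 1 →
      ∀ (f : CSeries), f ∈ Oan (algebraMap ℚ ℂ) → (∀ l : ℕ, UsesVar f l → l = i) →
      ∀ (r : ℝ), 2 + (∑ n ∈ u.support, ‖u.coeff n‖) < r →
        Summable (fun a : ℕ →₀ ℕ => ‖MvPowerSeries.coeff a f‖ * r ^ degree a) →
        f - MvPowerSeries.subst uFam[i, u] f * Polynomial.aeval (X i : CSeries) (Polynomial.derivative u) ∈ 𝕊 :=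
  stub_changeOfVariablesDimOne

/-- **LAYER 1.5 — LANDED** (`stub_genusZeroWithRoomLayer`, p168311): genus-0 one-variable integrands
with room and a polynomial parametrisation `u` making `F(u)u′` rational are type (a) when `∫F = 0`.
[cite: Ayoub2015, Rem. 1.5] -/
theorem genusZeroWithRoomLayer :
    ∀ (i : ℕ) (u : Polynomial ℂ), (∀ n, IsAlgebraic ℚ (u.coeff n)) → u.eval 0 = 0 → u.eval 1 = 1 →
      ∀ (F : CSeries), F ∈ Oan (algebraMap ℚ ℂ) → (∀ l : ℕ, UsesVar F l → l = i) →
      ∀ (r : ℝ), 2 + (∑ n ∈ u.support, ‖u.coeff n‖) < r →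
        Summable (fun a : ℕ →₀ ℕ => ‖MvPowerSeries.coeff a F‖ * r ^ degree a) →
        (∃ A B : Polynomial ℂ, B ≠ 0 ∧ (∀ n, IsAlgebraic ℚ (A.coeff n)) ∧
          (∀ n, IsAlgebraic ℚ (B.coeff n)) ∧
          Polynomial.aeval (X i : CSeries) B *
              (MvPowerSeries.subst uFam[i, u] F * Polynomial.aeval (X i : CSeries) (Polynomial.derivative u)) =
            Polynomial.aeval (X i : CSeries) A) →
        intC F = 0 → F ∈ 𝕊 :=
  stub_genusZeroWithRoomLayer

/-! ## Wave 4: multi-piece Layer 1, renaming invariance, module structure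

LANDED: F2 `stub_multiPieceRatLayer` (p167728: finite sums of one-variable rational pieces in
different variables with total `∫ = 0` are type (a)), R `stub_renameSpan` (p167698: renaming
invariance of `Oan` and of the span), M1 `stub_moduleDisjoint_of` (p168232: `F ∈ 𝕊`, `L ∈ Oan` free of
the variables of `F` ⟹ `F·L ∈ 𝕊`). Consequence recorded below: `moduleDisjoint`. -/

/-- **MODULE STRUCTURE (landed R + M1)**: the `ℚ`-span of type (a) is stable under multiplication by
elements of `𝒪_{ℚ-alg}(𝔻̄^∞)` in disjoint variables — Ayoub's type (b) generators `f·L` reduce to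
type (a) once `f` is type (a). [cite: AyoubRelKZRevisited, Théorème 1.1 (b)] -/
theorem moduleDisjoint (F L : CSeries) (hF : F ∈ 𝕊) (hL : L ∈ Oan (algebraMap ℚ ℂ))
    (hdis : ∀ l : ℕ, UsesVar L l → ¬ UsesVar F l) : F * L ∈ 𝕊 :=
  stub_moduleDisjoint_of stub_renameSpan F L hF hL hdis

/-- **Layer 1 ⊗ disjoint products** (Layer 1 + module structure): a one-variable rational kernel
element times any element of `𝒪_{ℚ-alg}(𝔻̄^∞)` in other variables is type (a) — the type-(b)
generators of Ayoub's relative theorem with a rational one-variable `f` are type (a).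
[cite: AyoubRelKZRevisited, Théorème 1.1 (b)] -/
theorem ratOneVarTimesDisjoint (i : ℕ) (F L : CSeries) (hF : F ∈ Oan (algebraMap ℚ ℂ))
    (hvar : ∀ l : ℕ, UsesVar F l → l = i)
    (hrat : ∃ A B : Polynomial ℂ, B ≠ 0 ∧ (∀ n, IsAlgebraic ℚ (A.coeff n)) ∧
      (∀ n, IsAlgebraic ℚ (B.coeff n)) ∧
      Polynomial.aeval (X i : CSeries) B * F = Polynomial.aeval (X i : CSeries) A)
    (h0 : intC F = 0) (hL : L ∈ Oan (algebraMap ℚ ℂ)) (hLi : ¬ UsesVar L i) : F * L ∈ 𝕊 :=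
  moduleDisjoint F L (stub_ratOneVarLayer ℚ (algebraMap ℚ ℂ) (fun c => isAlgebraic_algebraMap c) i F hF hvar
    hrat h0) hL fun l hl hFl => hLi (hvar l hFl ▸ hl)

/-! ## Wave 5: two instances — LANDED (F6 `stub_sqrtInstance_of` p168788, F7 `stub_barrierElementTypeA` p168789) -/

/-- **F6 — LANDED** (`stub_sqrtInstance_of`): THE FIRST IRRATIONAL ALGEBRAIC INSTANCE of Conj. 1.1
certified inside type (a) — `√(4 − z₀) − (2/3)(8 − 3√3)` is type (a) (Layer 1.5 with `u = 4ct − c²t²`,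
`c = 2 − √3`). [cite: Ayoub2015, Conj. 1.1] -/
theorem sqrtInstance :
    (2 : ℂ) • binGerm[0, (4 : ℂ), ((1 / 2 : ℚ) : ℂ)] - C ((16 / 3 : ℂ) - 2 * ((Real.sqrt 3 : ℝ) : ℂ)) ∈ 𝕊 :=
  stub_sqrtInstance_of stub_genusZeroWithRoomLayer

/-- **F7 — LANDED** (`stub_barrierElementTypeA`, p168789): the barrier catalogue's element
`2z₀/(2 − z₀²) − 1/(2 − z₀)` (`kernelElt_not_stokes_one_variable`: NO one-variable certificate) IS type (a)
(Layer 1; certificates with auxiliary variables, as Ayoub Rem. 1.2 predicts). [cite: Ayoub2015, Rem. 1.2] -/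
theorem barrierElementTypeA :
    ((-(2 : ℂ)⁻¹) • binGerm[0, (2 : ℂ), (-1 : ℂ)]
      - (-((Real.sqrt 2 : ℝ) : ℂ)⁻¹) • binGerm[0, ((Real.sqrt 2 : ℝ) : ℂ), (-1 : ℂ)]
      - (-(-((Real.sqrt 2 : ℝ) : ℂ))⁻¹) • binGerm[0, (-((Real.sqrt 2 : ℝ) : ℂ)), (-1 : ℂ)]) ∈ 𝕊 :=
  stub_barrierElementTypeA

/-! ## The one crux-strength stub -/

/-- **S7 — THE RESIDUAL (crux strength): type-(a) generation WITH ROOM.** For some radius `R`, every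
`F ∈ 𝒪_{k-alg}(𝔻̄^∞)` (`σ` with algebraic image) of polyradius `> R` with `∫_{[0,1]^∞} F = 0` lies in
the `k`-span of type (a). EQUIVALENT to the crux (`stub_roomNormalisation`, landed); it is the
honest residual of the line — every certificate of the compiler consumes room (Ayoub 2015 Rem. 1.2:
auxiliary variables cannot be bounded;
`Literature.Barriers.KontsevichZagierPeriods.KZ.kernelElt_not_stokes_one_variable`), and this
statement grants all of it. OPEN, of Grothendieck-period-conjecture strength. [cite: Ayoub2015, Conj. 1.1] -/
theorem stub_residual :
    ∃ R : ℝ, ∀ (k : Type) [Field k] [CharZero k] (σ : k →+* ℂ), (∀ c : k, IsAlgebraic ℚ (σ c)) →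
      ∀ F ∈ Oan σ, (∃ r : ℝ, R < r ∧ Summable fun a : ℕ →₀ ℕ => ‖MvPowerSeries.coeff a F‖ * r ^ degree a) →
        intC F = 0 → F ∈ kSpan σ {x : CSeries | ∃ G ∈ Oan σ, ∃ i : ℕ, x = relAC i G} := by
  sorry

/-! ## Composition -/

/-- **The crux from the stubs** — a single line since cycle 1: the landed room normalisation
(`typeAGeneration_of_residual`: room lemma S6 fed with S1–S5, the span integrates to zero,
`F = (F − P) + P`) applied to the residual S7. [cite: Ayoub2015, Conj. 1.1] -/
theorem TypeAGeneration_of : TypeAGeneration :=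
  typeAGeneration_of_residual stub_residual

end Summit.KontsevichZagierPeriods.KontsevichZagierPeriods.TypeAGenerationLine
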